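import Summits.KontsevichZagierPeriods.KontsevichZagierPeriods.Theorems.UnfoldedStokesDefs
import Summits.KontsevichZagierPeriods.KontsevichZagierPeriods.Theorems.UnfoldedStokesStokesGenerationLineReduction
import Literature.NumberTheory.Transcendental.KZProductIdeal
import Literature.NumberTheory.Transcendental.KZIntervalPeriodProofs
import Literature.NumberTheory.Transcendental.SemialgebraicMapsProofs

/-!
# `StokesGeneration` (stmt-KontsevichZagierPeriods-3586) — line `fibrewise_stokes`, stub `fibStokesDecomposable_add`

Closure properties of the S2 class, II: the class of FIBREWISE-STOKES DECOMPOSABLE functions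
(`FibStokesDecomposable M h`, `Theorems/UnfoldedStokesDefs.lean`) is stable under sums.

The two packages live on padded cubes `[0,1]^{M₁}`, `[0,1]^{M₂}` of possibly different dimensions. Step 1
(`exists_repad_family`) re-pads a family of fibrewise Stokes elements along the projection `pr` of `[0,1]^N` onto its
first `M'` coordinates (`N ≥ M'`): directions `Fin.castLE`, primitives / derivatives `G ∘ pr`, `D ∘ pr` (semialgebraic
by composition with the coordinate projection), kink sets `pr⁻¹ K` (coordinate preimages; the `i`-fibres are unchanged
because `pr` commutes with updating the coordinate, `comp_castLE_update`), and the carried closed-cube representations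
are lifted by dummy variables (`exists_liftCube`, Kontsevich–Zagier's rule (3)). The preimage of the null exceptional
set is a cylinder `Z × ℝ^d`, hence null (`KZ.volume_cylinder`). Step 2 concatenates the two re-padded families on the
common cube `[0,1]^{M₁+M₂}` (index set `Fin J₁ ⊕ Fin J₂ ≃ Fin (J₁ + J₂)`), with exceptional set the union of the two
cylinders. Pure bookkeeping; no analysis.

References: J. Ayoub, Ann. of Math. 181 (2015), Rem. 1.5; J. Bochnak, M. Coste, M.-F. Roy, *Real Algebraic Geometry*
(1998), §2.2; M. Kontsevich, D. Zagier, *Periods* (2001), §1.2.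
-/

noncomputable section

-- `Summit.KontsevichZagierPeriods.KontsevichZagierPeriods.…` is the tree's mandated layout (single-conjunct summit).
set_option linter.dupNamespace false

namespace Summit.KontsevichZagierPeriods.KontsevichZagierPeriods.Cruxes.StokesGeneration.FibrewiseStokes

open MeasureTheory Set
open Literature.NumberTheory.Transcendental
open Literature.NumberTheory.Transcendental.KZ
open Literature.ModelTheory.ExponentialFields (IsSemialgebraic)

/-- Projecting to the first `M'` coordinates commutes with updating one of them. [folklore] -/
theorem comp_castLE_update {M' N : ℕ} (hle : M' ≤ N) (x : Fin N → ℝ) (a : Fin M') (s : ℝ) :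
    (fun k => Function.update x (Fin.castLE hle a) s (Fin.castLE hle k)) =
      Function.update (fun k => x (Fin.castLE hle k)) a s := by
  ext k
  by_cases hk : k = a
  · subst hk; simp
  · rw [Function.update_of_ne hk, Function.update_of_ne (fun h => hk (Fin.castLE_injective hle h))]

/-- The projection of the closed unit cube `[0,1]^N` to the first `M'` coordinates lands in `[0,1]^{M'}`. [folklore] -/
theorem comp_castLE_mem_pi {M' N : ℕ} (hle : M' ≤ N) {x : Fin N → ℝ}
    (hx : x ∈ Set.pi Set.univ (fun _ : Fin N => Set.Icc (0:ℝ) 1)) :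
    (fun k => x (Fin.castLE hle k)) ∈ Set.pi Set.univ (fun _ : Fin M' => Set.Icc (0:ℝ) 1) :=
  fun k _ => hx (Fin.castLE hle k) (Set.mem_univ _)

/-- A `ℚ`-semialgebraic function on `[0,1]^{M'}` composed with the projection to the first `M'` coordinates is
`ℚ`-semialgebraic on `[0,1]^N` (composition with a polynomial map). [cite: BochnakCosteRoy1998, Prop. 2.2.6] -/
theorem isSemialgebraicFunOn_comp_castLE {M' N : ℕ} (hle : M' ≤ N) {F : (Fin M' → ℝ) → ℝ}
    (hF : IsSemialgebraicFunOn ℚ (Set.pi Set.univ (fun _ : Fin M' => Set.Icc (0:ℝ) 1)) F) :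
    IsSemialgebraicFunOn ℚ (Set.pi Set.univ (fun _ : Fin N => Set.Icc (0:ℝ) 1))
      (fun x => F (fun k => x (Fin.castLE hle k))) := by
  have hS : IsSemialgebraic ℚ (Set.pi Set.univ (fun _ : Fin N => Set.Icc (0:ℝ) 1)) := by
    rw [← cube_eq_pi]; exact isSemialgebraic_cube
  exact IsSemialgebraicFunOn.comp_isSemialgebraicMapOn_holds hF
    (IsSemialgebraicMapOn.of_forall hS fun k => isSemialgebraicFunOn_apply hS (Fin.castLE hle k))
    (fun x hx => comp_castLE_mem_pi hle hx)

/-- The preimage of a Lebesgue-null set under the projection to the first `M'` coordinates is null (it is the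
cylinder `Z × ℝ^d`, of volume `vol Z · vol ℝ^d = 0`). [folklore] -/
theorem volume_setOf_comp_castLE_mem {M' N : ℕ} (hle : M' ≤ N) {Z : Set (Fin M' → ℝ)} (hZ : volume Z = 0) :
    volume {x : Fin N → ℝ | (fun k => x (Fin.castLE hle k)) ∈ Z} = 0 := by
  obtain ⟨d, rfl⟩ := Nat.exists_eq_add_of_le hle
  have hset : {x : Fin (M' + d) → ℝ | (fun k => x (Fin.castLE hle k)) ∈ Z} =
      {z : Fin (M' + d) → ℝ | (fun i => z (Fin.castAdd d i)) ∈ Z ∧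
        (fun j => z (Fin.natAdd M' j)) ∈ (Set.univ : Set (Fin d → ℝ))} := by
    ext x
    simp only [Set.mem_setOf_eq, Set.mem_univ, and_true]
    exact Iff.rfl
  rw [hset, volume_cylinder, hZ, zero_mul]

/-- **Re-padding a family of fibrewise Stokes elements.** A family of fibrewise Stokes elements on `[0,1]^{M'}`
(directions `i`, primitives `G`, derivatives `D`, kink sets `K`, carried closed-cube representations `q`) is pulled
back along the projection `pr` of `[0,1]^N` onto the first `M'` coordinates, `M' ≤ N`, to a family on `[0,1]^N`
whose carried representations have integrands `(q j).integrand ∘ pr` on the cube (lifting by dummy variables,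
Kontsevich–Zagier's rule (3)). [cite: KontsevichZagier2001, §1.2 rule (3)] -/
theorem exists_repad_family {M' N : ℕ} (hle : M' ≤ N) {J : ℕ} (i : Fin J → Fin M')
    (G D : Fin J → (Fin M' → ℝ) → ℝ) (K : Fin J → Set (Fin M' → ℝ)) (q : Fin J → IntegralRep M')
    (hpack : ∀ j, IsSemialgebraicFunOn ℚ (Set.pi Set.univ (fun _ : Fin M' => Set.Icc (0:ℝ) 1)) (G j) ∧
      IsSemialgebraicFunOn ℚ (Set.pi Set.univ (fun _ : Fin M' => Set.Icc (0:ℝ) 1)) (D j) ∧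
      IsSemialgebraic ℚ (K j) ∧
      (∃ B : ℝ, ∀ x ∈ Set.pi Set.univ (fun _ : Fin M' => Set.Icc (0:ℝ) 1), |(G j) x| ≤ B) ∧
      (∀ x ∈ Set.pi Set.univ (fun _ : Fin M' => Set.Icc (0:ℝ) 1),
        Set.Finite {s : ℝ | Function.update x (i j) s ∈ (K j)}) ∧
      (∀ x ∈ Set.pi Set.univ (fun _ : Fin M' => Set.Icc (0:ℝ) 1),
        ContinuousOn (fun s : ℝ => (G j) (Function.update x (i j) s)) (Set.Icc (0:ℝ) 1)) ∧
      (∀ x ∈ Set.pi Set.univ (fun _ : Fin M' => Set.Icc (0:ℝ) 1), x ∉ (K j) → x (i j) ∈ Set.Ioo (0:ℝ) 1 →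
        HasDerivAt (fun s : ℝ => (G j) (Function.update x (i j) s)) ((D j) x) (x (i j))))
    (hq : ∀ j, (q j).domain = Set.pi Set.univ (fun _ : Fin M' => Set.Icc (0:ℝ) 1) ∧
      ∀ x ∈ Set.pi Set.univ (fun _ : Fin M' => Set.Icc (0:ℝ) 1), (q j).integrand x =
        D j x - (G j (Function.update x (i j) 1) - G j (Function.update x (i j) 0))) :
    ∃ (i' : Fin J → Fin N) (G' D' : Fin J → (Fin N → ℝ) → ℝ) (K' : Fin J → Set (Fin N → ℝ))
      (q' : Fin J → IntegralRep N),
      (∀ j, IsSemialgebraicFunOn ℚ (Set.pi Set.univ (fun _ : Fin N => Set.Icc (0:ℝ) 1)) (G' j) ∧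
        IsSemialgebraicFunOn ℚ (Set.pi Set.univ (fun _ : Fin N => Set.Icc (0:ℝ) 1)) (D' j) ∧
        IsSemialgebraic ℚ (K' j) ∧
        (∃ B : ℝ, ∀ x ∈ Set.pi Set.univ (fun _ : Fin N => Set.Icc (0:ℝ) 1), |(G' j) x| ≤ B) ∧
        (∀ x ∈ Set.pi Set.univ (fun _ : Fin N => Set.Icc (0:ℝ) 1),
          Set.Finite {s : ℝ | Function.update x (i' j) s ∈ (K' j)}) ∧
        (∀ x ∈ Set.pi Set.univ (fun _ : Fin N => Set.Icc (0:ℝ) 1),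
          ContinuousOn (fun s : ℝ => (G' j) (Function.update x (i' j) s)) (Set.Icc (0:ℝ) 1)) ∧
        (∀ x ∈ Set.pi Set.univ (fun _ : Fin N => Set.Icc (0:ℝ) 1), x ∉ (K' j) → x (i' j) ∈ Set.Ioo (0:ℝ) 1 →
          HasDerivAt (fun s : ℝ => (G' j) (Function.update x (i' j) s)) ((D' j) x) (x (i' j)))) ∧
      (∀ j, (q' j).domain = Set.pi Set.univ (fun _ : Fin N => Set.Icc (0:ℝ) 1) ∧
        ∀ x ∈ Set.pi Set.univ (fun _ : Fin N => Set.Icc (0:ℝ) 1), (q' j).integrand x =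
          D' j x - (G' j (Function.update x (i' j) 1) - G' j (Function.update x (i' j) 0))) ∧
      ∀ j, ∀ x ∈ Set.pi Set.univ (fun _ : Fin N => Set.Icc (0:ℝ) 1),
        (q' j).integrand x = (q j).integrand (fun k => x (Fin.castLE hle k)) := by
  -- the carried representations, lifted by dummy variables
  have hlift : ∀ j, ∃ t' : IntegralRep N, t'.domain = Set.pi Set.univ (fun _ : Fin N => Set.Icc (0:ℝ) 1) ∧
      ∀ x ∈ Set.pi Set.univ (fun _ : Fin N => Set.Icc (0:ℝ) 1),
        t'.integrand x = (q j).integrand (fun k => x (Fin.castLE hle k)) := fun j => by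
    obtain ⟨t', h1, h2, -⟩ :=
      Summit.KontsevichZagierPeriods.KontsevichZagierPeriods.StokesGenerationLine.exists_liftCube M' N hle (q j)
        (hq j).1
    exact ⟨t', h1, h2⟩
  choose q' hq'd hq'i using hlift
  have hpr : ∀ x ∈ Set.pi Set.univ (fun _ : Fin N => Set.Icc (0:ℝ) 1),
      (fun k => x (Fin.castLE hle k)) ∈ Set.pi Set.univ (fun _ : Fin M' => Set.Icc (0:ℝ) 1) :=
    fun x hx => comp_castLE_mem_pi hle hx
  have hfun : ∀ (j : Fin J) (x : Fin N → ℝ),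
      (fun s : ℝ => G j (fun k => Function.update x (Fin.castLE hle (i j)) s (Fin.castLE hle k))) =
        fun s => G j (Function.update (fun k => x (Fin.castLE hle k)) (i j) s) := by
    intro j x
    funext s
    rw [comp_castLE_update]
  refine ⟨fun j => Fin.castLE hle (i j), fun j x => G j (fun k => x (Fin.castLE hle k)),
    fun j x => D j (fun k => x (Fin.castLE hle k)), fun j => {x | (fun k => x (Fin.castLE hle k)) ∈ K j}, q',
    fun j => ?_, fun j => ⟨hq'd j, fun x hx => ?_⟩, fun j x hx => hq'i j x hx⟩
  · obtain ⟨h1, h2, h3, ⟨B, hB⟩, h5, h6, h7⟩ := hpack j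
    refine ⟨isSemialgebraicFunOn_comp_castLE hle h1, isSemialgebraicFunOn_comp_castLE hle h2,
      h3.preimage_comp (Fin.castLE hle), ⟨B, fun x hx => hB _ (hpr x hx)⟩, fun x hx => ?_, fun x hx => ?_,
      fun x hx hxK hxj => ?_⟩
    · refine (h5 _ (hpr x hx)).subset fun s hs => ?_
      have hs' : (fun k => Function.update x (Fin.castLE hle (i j)) s (Fin.castLE hle k)) ∈ K j := hs
      show Function.update (fun k => x (Fin.castLE hle k)) (i j) s ∈ K j
      rwa [← comp_castLE_update hle x (i j) s]
    · show ContinuousOn (fun s : ℝ => G j (fun k => Function.update x (Fin.castLE hle (i j)) s (Fin.castLE hle k)))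
        (Set.Icc (0:ℝ) 1)
      rw [hfun j x]
      exact h6 _ (hpr x hx)
    · have hxK' : (fun k => x (Fin.castLE hle k)) ∉ K j := hxK
      show HasDerivAt (fun s : ℝ => G j (fun k => Function.update x (Fin.castLE hle (i j)) s (Fin.castLE hle k)))
        (D j (fun k => x (Fin.castLE hle k))) (x (Fin.castLE hle (i j)))
      rw [hfun j x]
      exact h7 _ (hpr x hx) hxK' hxj
  · rw [hq'i j x hx, (hq j).2 _ (hpr x hx)]
    show _ = D j (fun k => x (Fin.castLE hle k)) -
      (G j (fun k => Function.update x (Fin.castLE hle (i j)) 1 (Fin.castLE hle k)) -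
        G j (fun k => Function.update x (Fin.castLE hle (i j)) 0 (Fin.castLE hle k)))
    rw [comp_castLE_update, comp_castLE_update]

/-- **Sums (registered stub `fibStokesDecomposable_add`).** The class of fibrewise-Stokes decomposable functions is
stable under `h₁ + h₂`: re-pad both packages to the common cube `[0,1]^{M₁+M₂}` (`exists_repad_family`; the
exceptional sets become null cylinders) and concatenate the two families of elements (`Fin J₁ ⊕ Fin J₂`); off the
union of the two exceptional sets the sum of all integrands is `h₁ ∘ pr + h₂ ∘ pr`.
[cite: Ayoub2015, Rem. 1.5] -/
theorem fibStokesDecomposable_add :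
    ∀ (M : ℕ) (h₁ h₂ : (Fin M → ℝ) → ℝ), FibStokesDecomposable M h₁ → FibStokesDecomposable M h₂ →
      FibStokesDecomposable M (fun x => h₁ x + h₂ x) := by
  intro M h₁ h₂ ⟨M₁, hM₁, J₁, i₁, G₁, D₁, K₁, q₁, Z₁, hpack₁, hq₁, hZs₁, hZ0₁, hid₁⟩
    ⟨M₂, hM₂, J₂, i₂, G₂, D₂, K₂, q₂, Z₂, hpack₂, hq₂, hZs₂, hZ0₂, hid₂⟩
  -- Step 1: re-pad both packages to the common cube `[0,1]^(M₁ + M₂)`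
  have hle₁ : M₁ ≤ M₁ + M₂ := Nat.le_add_right M₁ M₂
  have hle₂ : M₂ ≤ M₁ + M₂ := Nat.le_add_left M₂ M₁
  obtain ⟨i₁', G₁', D₁', K₁', q₁', hpack₁', hq₁', hrel₁⟩ := exists_repad_family hle₁ i₁ G₁ D₁ K₁ q₁ hpack₁ hq₁
  obtain ⟨i₂', G₂', D₂', K₂', q₂', hpack₂', hq₂', hrel₂⟩ := exists_repad_family hle₂ i₂ G₂ D₂ K₂ q₂ hpack₂ hq₂
  -- Step 2: concatenate the two families
  set S : Set (Fin (M₁ + M₂) → ℝ) := Set.pi Set.univ (fun _ : Fin (M₁ + M₂) => Set.Icc (0:ℝ) 1) with hS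
  let ι := Fin J₁ ⊕ Fin J₂
  let e : Fin (J₁ + J₂) ≃ ι := finSumFinEquiv.symm
  let iι : ι → Fin (M₁ + M₂) := Sum.elim i₁' i₂'
  let Gι : ι → (Fin (M₁ + M₂) → ℝ) → ℝ := Sum.elim G₁' G₂'
  let Dι : ι → (Fin (M₁ + M₂) → ℝ) → ℝ := Sum.elim D₁' D₂'
  let Kι : ι → Set (Fin (M₁ + M₂) → ℝ) := Sum.elim K₁' K₂'
  let qι : ι → IntegralRep (M₁ + M₂) := Sum.elim q₁' q₂'
  have hcond : ∀ s : ι, IsSemialgebraicFunOn ℚ S (Gι s) ∧ IsSemialgebraicFunOn ℚ S (Dι s) ∧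
      IsSemialgebraic ℚ (Kι s) ∧ (∃ B : ℝ, ∀ x ∈ S, |(Gι s) x| ≤ B) ∧
      (∀ x ∈ S, Set.Finite {s' : ℝ | Function.update x (iι s) s' ∈ (Kι s)}) ∧
      (∀ x ∈ S, ContinuousOn (fun s' : ℝ => (Gι s) (Function.update x (iι s) s')) (Set.Icc (0:ℝ) 1)) ∧
      (∀ x ∈ S, x ∉ (Kι s) → x (iι s) ∈ Set.Ioo (0:ℝ) 1 →
        HasDerivAt (fun s' : ℝ => (Gι s) (Function.update x (iι s) s')) ((Dι s) x) (x (iι s))) := by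
    rintro (j | j)
    · exact hpack₁' j
    · exact hpack₂' j
  have hqc : ∀ s : ι, (qι s).domain = S ∧ ∀ x ∈ S, (qι s).integrand x =
      Dι s x - (Gι s (Function.update x (iι s) 1) - Gι s (Function.update x (iι s) 0)) := by
    rintro (j | j)
    · exact hq₁' j
    · exact hq₂' j
  refine ⟨M₁ + M₂, hM₁.trans hle₁, J₁ + J₂, fun j => iι (e j), fun j => Gι (e j), fun j => Dι (e j),
    fun j => Kι (e j), fun j => qι (e j),
    {x | (fun k => x (Fin.castLE hle₁ k)) ∈ Z₁} ∪ {x | (fun k => x (Fin.castLE hle₂ k)) ∈ Z₂},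
    fun j => hcond (e j), fun j => hqc (e j),
    (hZs₁.preimage_comp (Fin.castLE hle₁)).union (hZs₂.preimage_comp (Fin.castLE hle₂)),
    measure_union_null (volume_setOf_comp_castLE_mem hle₁ hZ0₁) (volume_setOf_comp_castLE_mem hle₂ hZ0₂),
    fun x hx hxZ => ?_⟩
  -- the identity off the union of the two exceptional cylinders
  have hx₁ : (fun k => x (Fin.castLE hle₁ k)) ∈ Set.pi Set.univ (fun _ : Fin M₁ => Set.Icc (0:ℝ) 1) :=
    comp_castLE_mem_pi hle₁ hx
  have hx₂ : (fun k => x (Fin.castLE hle₂ k)) ∈ Set.pi Set.univ (fun _ : Fin M₂ => Set.Icc (0:ℝ) 1) :=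
    comp_castLE_mem_pi hle₂ hx
  have hxZ₁ : (fun k => x (Fin.castLE hle₁ k)) ∉ Z₁ := fun h => hxZ (Or.inl h)
  have hxZ₂ : (fun k => x (Fin.castLE hle₂ k)) ∉ Z₂ := fun h => hxZ (Or.inr h)
  have e₁ := hid₁ _ hx₁ hxZ₁
  have e₂ := hid₂ _ hx₂ hxZ₂
  have hr₁ : ∀ j, (q₁' j).integrand x = (q₁ j).integrand (fun k => x (Fin.castLE hle₁ k)) :=
    fun j => hrel₁ j x hx
  have hr₂ : ∀ j, (q₂' j).integrand x = (q₂ j).integrand (fun k => x (Fin.castLE hle₂ k)) :=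
    fun j => hrel₂ j x hx
  have hsum : ∑ j : Fin (J₁ + J₂), (qι (e j)).integrand x = ∑ s : ι, (qι s).integrand x :=
    Equiv.sum_comp e (fun s => (qι s).integrand x)
  show h₁ (fun l => x (Fin.castLE (hM₁.trans hle₁) l)) + h₂ (fun l => x (Fin.castLE (hM₁.trans hle₁) l)) =
    ∑ j : Fin (J₁ + J₂), (qι (e j)).integrand x
  rw [hsum, Fintype.sum_sum_type]
  simp only [qι, Sum.elim_inl, Sum.elim_inr, hr₁, hr₂]
  rw [← e₁, ← e₂]
  rfl

end Summit.KontsevichZagierPeriods.KontsevichZagierPeriods.Cruxes.StokesGeneration.FibrewiseStokes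

end
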